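import Literature.Probability.Percolation.Crossings
import HarnessLib

/-!
# Bollobás–Riordan's chaining count: one random translate of a short steep path links `A` to `B`

Topic `Literature/Probability/Percolation`.

Bollobás–Riordan, *Percolation on self-dual polygon configurations* (2010, arXiv:1001.4674),
§5.1, proof of Theorem 5.3, pp. 23–24 (the "virtual path `P*`", the colouring of `R₀` with
`I + 1` colours, and the pigeonhole giving `Pr(X ∈ C'_i) ≥ γ²α/400`). This is the purely
combinatorial heart of their translation-only Russo–Seymour–Welsh argument, isolated from all
planar topology and all probability:

**Setting.** `T` is any set of lattice points (the strip), covered by three sets `A` ("on or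
below the lowest crossing of `S₁`"), `B` ("on or above the highest crossing of `S₂`") and a finite
`G` (the gap). `P` is a finite set of lattice points (the open path found in the independent
configuration `ω₂`) with two marked points `s`, `e` (its endpoints) and displacement
`off = e - s`. `R₀` is a finite set of admissible starting points (the `γn`-square below `S₁`) and
`I` the number of links, such that every link of every chain started in `R₀` stays in `T`
(`hT`), chains start in `A` (`hA : R₀ ⊆ A`) and end in `B` (`hB`).

**Conclusion** (`exists_translates_linking`). There is a finite set `Xs` of translation vectors,
each of the form `v - s + (i - 1) • off` (`v ∈ R₀`, `1 ≤ i ≤ I`), such that for every `X ∈ Xs`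
the translate `P + X` lies in `T`, starts in `A` (`s + X ∈ A`) and ends in `B` (`e + X ∈ B`),
and `#R₀ ≤ I · #Xs + (I - 1) · #G`. (B–R: colour `v ∈ R₀` with `0` if some intermediate chain
point `v + i • off`, `1 ≤ i < I`, lies in `G` — at most `(I-1) #G` such `v`, translation being
injective — and otherwise with the least `i ≥ 1` such that `v + i • off ∈ B`, whose predecessor
then lies in `A`; some colour class `C_i`, `i ≥ 1`, has at least `(#R₀ - (I-1)#G)/I` points, and
`X = v - s + (i-1) • off`, `v ∈ C_i`, are the sought translations.) With `#R₀ = γ²n²`,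
`#G ≤ ε n²`, `I ≤ 2/α`, `ε < γ²α/10` this is B–R's `#C'_i ≥ γ²α n²/4`.

`exists_translates_linking_strip` specialises this to the strip `T = [0, n] × ℤ` of `ℤ²` with
the starting square `R₀ = [x₀, x₀ + r] × [y₀, y₀ + r]`, making B–R's rounding explicit: the chain
fits horizontally as soon as the four endpoint inequalities (B–R's display
"`(2β₁+γ)n + I(x'-x) ≤ … ≤ n`", at `j = 0` and `j = I`) hold, and then
`(r + 1)² ≤ I · #Xs + (I - 1) · #G` with all `X` in an explicit window.

Not here: the choice of the constants `x₀ = ⌈β₁ n⌉`, `r = ⌊γ n⌋`, `I = ⌈(y_B + r + 1)/a⌉` from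
`η ≥ 3β₁ + 3γ` (real arithmetic), and the probabilistic wrapping (uniform `X` on `[-5n, 5n-1]²`).

## References

* B. Bollobás, O. Riordan, *Percolation on self-dual polygon configurations*, Bolyai Soc. Math.
  Stud. 21 (2010) 131–217, arXiv:1001.4674, §5.1, proof of Thm. 5.3. [BollobasRiordan2010]
-/

namespace Literature.Probability.Percolation

open Finset

variable {V : Type*} [AddCommGroup V]

/-- For fixed `i`, `v ↦ v + i • off` is injective (a translation). [folklore] -/
theorem chainPoint_injective (off : V) (i : ℕ) : Function.Injective fun v : V => v + i • off :=
  fun v w h => by simpa using h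

/-- The start of the `i`-th link `X = v - s + (i - 1) • off` is the `(i-1)`-st chain point. [folklore] -/
theorem start_add_linkShift (off s v : V) (i : ℕ) : s + (v - s + (i - 1) • off) = v + (i - 1) • off := by
  abel

/-- The end of the `i`-th link (`i ≥ 1`) is the `i`-th chain point. [folklore] -/
theorem end_add_linkShift (s e v : V) {i : ℕ} (hi : 1 ≤ i) :
    e + (v - s + (i - 1) • (e - s)) = v + i • (e - s) := by
  obtain ⟨j, rfl⟩ : ∃ j, i = j + 1 := ⟨i - 1, by omega⟩
  simp only [Nat.add_sub_cancel, add_smul, one_smul]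
  abel

/-- For fixed `i`, `v ↦ v - s + (i - 1) • off` is injective. [folklore] -/
theorem linkShift_injective (off s : V) (i : ℕ) : Function.Injective fun v : V => v - s + (i - 1) • off :=
  fun v w h => by simpa using h

/-- **Bollobás–Riordan's chaining count** (proof of Thm. 5.3, the colouring of `R₀` and the
pigeonhole). Let `T ⊆ A ∪ B ∪ G` with `G` finite; `P` finite with marked points `s, e ∈ P`,
`off = e - s`; `R₀` finite and `I ≥ 1` such that (i) every link of every chain from `R₀` lies in
`T`: `z + (v - s + j • off) ∈ T` for `z ∈ P`, `v ∈ R₀`, `j < I`; (ii) `R₀ ⊆ A`; (iii) the chains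
end in `B`: `v + I • off ∈ B`. Then there is a finite set `Xs` of vectors of the form
`v - s + (i-1) • off` (`v ∈ R₀`, `1 ≤ i ≤ I`) with `s + X ∈ A`, `e + X ∈ B`, `P + X ⊆ T` for all
`X ∈ Xs`, and `#R₀ ≤ I · #Xs + (I - 1) · #G`. [cite: BollobasRiordan2010, §5.1 proof of Thm. 5.3] -/
theorem exists_translates_linking (T A B : Set V) (G : Finset V) (hcover : ∀ z ∈ T, z ∈ A ∨ z ∈ B ∨ z ∈ G)
    (P : Finset V) {s e : V} (hs : s ∈ P) (R₀ : Finset V) {I : ℕ} (hI : 1 ≤ I)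
    (hT : ∀ v ∈ R₀, ∀ j < I, ∀ z ∈ P, z + (v - s + j • (e - s)) ∈ T)
    (hA : ∀ v ∈ R₀, v ∈ A) (hB : ∀ v ∈ R₀, v + I • (e - s) ∈ B) :
    ∃ Xs : Finset V, (∀ X ∈ Xs, ∃ v ∈ R₀, ∃ i, 1 ≤ i ∧ i ≤ I ∧ X = v - s + (i - 1) • (e - s)) ∧
      (∀ X ∈ Xs, s + X ∈ A ∧ e + X ∈ B ∧ ∀ z ∈ P, z + X ∈ T) ∧
      R₀.card ≤ I * Xs.card + (I - 1) * G.card := by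
  classical
  set off := e - s with hoff
  -- chain points of index `j < I` lie in `T` (they are the starts of links)
  have hchainT : ∀ v ∈ R₀, ∀ j < I, v + j • off ∈ T := by
    intro v hv j hj
    have := hT v hv j hj s hs
    convert this using 1
    abel
  -- colour 0: some intermediate chain point lies in the gap
  set C₀ : Finset V := R₀.filter fun v => ∃ j, 1 ≤ j ∧ j < I ∧ v + j • off ∈ G with hC₀
  have hC₀card : C₀.card ≤ (I - 1) * G.card := by
    have hsub : C₀ ⊆ (Finset.Ico 1 I).biUnion fun j => R₀.filter fun v => v + j • off ∈ G := by
      intro v hv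
      rw [hC₀, Finset.mem_filter] at hv
      obtain ⟨hvR, j, hj1, hjI, hjG⟩ := hv
      exact Finset.mem_biUnion.2 ⟨j, Finset.mem_Ico.2 ⟨hj1, hjI⟩, Finset.mem_filter.2 ⟨hvR, hjG⟩⟩
    have heach : ∀ j ∈ Finset.Ico 1 I, (R₀.filter fun v => v + j • off ∈ G).card ≤ G.card := by
      intro j _
      refine Finset.card_le_card_of_injOn (fun v => v + j • off) (fun v hv => ?_)
        fun v _ w _ h => chainPoint_injective off j h
      exact (Finset.mem_filter.1 hv).2
    calc C₀.card ≤ ((Finset.Ico 1 I).biUnion fun j => R₀.filter fun v => v + j • off ∈ G).card :=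
          Finset.card_le_card hsub
      _ ≤ ∑ j ∈ Finset.Ico 1 I, (R₀.filter fun v => v + j • off ∈ G).card := Finset.card_biUnion_le
      _ ≤ ∑ _j ∈ Finset.Ico 1 I, G.card := Finset.sum_le_sum heach
      _ = (I - 1) * G.card := by rw [Finset.sum_const, Nat.card_Ico, smul_eq_mul]
  -- colour `i ≥ 1`: the `(i-1)`-st chain point is in `A` and the `i`-th in `B`
  set C : ℕ → Finset V := fun i => R₀.filter fun v => v + (i - 1) • off ∈ A ∧ v + i • off ∈ B
    with hC
  have hcolour : ∀ v ∈ R₀, v ∉ C₀ → ∃ i, 1 ≤ i ∧ i ≤ I ∧ v ∈ C i := by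
    intro v hv hv0
    have hex : ∃ i, 1 ≤ i ∧ i ≤ I ∧ v + i • off ∈ B := ⟨I, hI, le_rfl, hB v hv⟩
    refine ⟨Nat.find hex, (Nat.find_spec hex).1, (Nat.find_spec hex).2.1, ?_⟩
    rw [hC, Finset.mem_filter]
    refine ⟨hv, ?_, (Nat.find_spec hex).2.2⟩
    set i := Nat.find hex with hi
    have hi1 : 1 ≤ i := (Nat.find_spec hex).1
    have hiI : i ≤ I := (Nat.find_spec hex).2.1
    by_cases h1 : i = 1
    · rw [h1]; simpa using hA v hv
    -- `i - 1 ≥ 1` is not a `B`-index (minimality), not a `G`-index (colour ≠ 0), and lies in `T`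
    have hnotB : v + (i - 1) • off ∉ B := by
      intro hmem
      have := Nat.find_min hex (m := i - 1) (by omega)
      exact this ⟨by omega, by omega, hmem⟩
    have hnotG : v + (i - 1) • off ∉ G := by
      intro hmem
      apply hv0
      rw [hC₀, Finset.mem_filter]
      exact ⟨hv, i - 1, by omega, by omega, hmem⟩
    rcases hcover _ (hchainT v hv (i - 1) (by omega)) with h | h | h
    · exact h
    · exact absurd h hnotB
    · exact absurd h hnotG
  -- pigeonhole over the colours `1, …, I`
  have hcoverR : R₀ ⊆ C₀ ∪ (Finset.Icc 1 I).biUnion C := by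
    intro v hv
    by_cases hv0 : v ∈ C₀
    · exact Finset.mem_union_left _ hv0
    · obtain ⟨i, hi1, hiI, hvi⟩ := hcolour v hv hv0
      exact Finset.mem_union_right _ (Finset.mem_biUnion.2 ⟨i, Finset.mem_Icc.2 ⟨hi1, hiI⟩, hvi⟩)
  obtain ⟨i₀, hi₀, hmax⟩ : ∃ i₀ ∈ Finset.Icc 1 I, ∀ i ∈ Finset.Icc 1 I, (C i).card ≤ (C i₀).card :=
    Finset.exists_max_image (Finset.Icc 1 I) (fun i => (C i).card) ⟨1, Finset.mem_Icc.2 ⟨le_rfl, hI⟩⟩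
  have hcount : R₀.card ≤ I * (C i₀).card + (I - 1) * G.card := by
    calc R₀.card ≤ (C₀ ∪ (Finset.Icc 1 I).biUnion C).card := Finset.card_le_card hcoverR
      _ ≤ C₀.card + ((Finset.Icc 1 I).biUnion C).card := Finset.card_union_le _ _
      _ ≤ C₀.card + ∑ i ∈ Finset.Icc 1 I, (C i).card := Nat.add_le_add_left Finset.card_biUnion_le _
      _ ≤ (I - 1) * G.card + ∑ _i ∈ Finset.Icc 1 I, (C i₀).card :=
          Nat.add_le_add hC₀card (Finset.sum_le_sum hmax)
      _ = I * (C i₀).card + (I - 1) * G.card := by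
          rw [Finset.sum_const, Nat.card_Icc, Nat.add_sub_cancel, smul_eq_mul]; omega
  -- the translations: `X = v - s + (i₀ - 1) • off`, `v ∈ C i₀`
  have hi₀1 : 1 ≤ i₀ := (Finset.mem_Icc.1 hi₀).1
  have hi₀I : i₀ ≤ I := (Finset.mem_Icc.1 hi₀).2
  refine ⟨(C i₀).image fun v => v - s + (i₀ - 1) • off, ?_, ?_, ?_⟩
  · intro X hX
    obtain ⟨v, hv, rfl⟩ := Finset.mem_image.1 hX
    exact ⟨v, (Finset.mem_filter.1 hv).1, i₀, hi₀1, hi₀I, rfl⟩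
  · intro X hX
    obtain ⟨v, hv, rfl⟩ := Finset.mem_image.1 hX
    obtain ⟨hvR, hvA, hvB⟩ := Finset.mem_filter.1 hv
    refine ⟨by rwa [start_add_linkShift], by rwa [hoff, end_add_linkShift s e v hi₀1], fun z hz => ?_⟩
    exact hT v hvR (i₀ - 1) (by omega) z hz
  · rwa [Finset.card_image_of_injective _ (linkShift_injective off s i₀)]

/-! ### The chain in the strip of `ℤ²` -/

section Strip

open LatticeModels

/-- First coordinate of a chain/link translate in `ℤ²`. [folklore] -/
theorem apply_add_linkVec_zero (z v s e : Site 2) (j : ℕ) :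
    (z + (v - s + j • (e - s))) 0 = z 0 + v 0 - s 0 + j * (e 0 - s 0) := by
  simp only [Pi.add_apply, Pi.sub_apply, Pi.smul_apply]
  rw [nsmul_eq_mul]
  ring

/-- Second coordinate of a chain/link translate in `ℤ²`. [folklore] -/
theorem apply_add_linkVec_one (z v s e : Site 2) (j : ℕ) :
    (z + (v - s + j • (e - s))) 1 = z 1 + v 1 - s 1 + j * (e 1 - s 1) := by
  simp only [Pi.add_apply, Pi.sub_apply, Pi.smul_apply]
  rw [nsmul_eq_mul]
  ring

/-- Coordinates of a chain point in `ℤ²`. [folklore] -/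
theorem chainPoint_apply (off v : Site 2) (I : ℕ) (k : Fin 2) : (v + I • off) k = v k + I * off k := by
  simp only [Pi.add_apply, Pi.smul_apply]
  rw [nsmul_eq_mul]

/-- Coordinates of a link shift in `ℤ²`. [folklore] -/
theorem linkShift_apply (off s v : Site 2) (i : ℕ) (k : Fin 2) :
    (v - s + (i - 1) • off) k = v k - s k + ((i - 1 : ℕ) : ℤ) * off k := by
  simp only [Pi.add_apply, Pi.sub_apply, Pi.smul_apply]
  rw [nsmul_eq_mul]

/-- A linear function of `j ∈ [0, I]` lies between its values at the endpoints. [folklore] -/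
theorem linear_mem_Icc_of_endpoints {c d lo hi : ℤ} {I j : ℕ} (hj : j ≤ I)
    (hlo0 : lo ≤ c) (hloI : lo ≤ c + I * d) (hhi0 : c ≤ hi) (hhiI : c + I * d ≤ hi) :
    lo ≤ c + j * d ∧ c + j * d ≤ hi := by
  have hjI : (j : ℤ) ≤ I := by exact_mod_cast hj
  have hj0 : (0 : ℤ) ≤ j := by exact_mod_cast Nat.zero_le j
  rcases le_or_gt 0 d with hd | hd
  · constructor <;> nlinarith
  · constructor <;> nlinarith

/-- The lattice square `[x₀, x₀ + r] × [y₀, y₀ + r]` has `(r + 1)²` points. [folklore] -/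
theorem card_Icc_square (x₀ y₀ : ℤ) (r : ℕ) :
    (Finset.Icc ![x₀, y₀] ![x₀ + r, y₀ + r] : Finset (Site 2)).card = (r + 1) ^ 2 := by
  rw [Pi.card_Icc, Fin.prod_univ_two]
  simp only [Matrix.cons_val_zero, Matrix.cons_val_one, Int.card_Icc]
  have h1 : (x₀ + r + 1 - x₀ : ℤ).toNat = r + 1 := by omega
  have h2 : (y₀ + r + 1 - y₀ : ℤ).toNat = r + 1 := by omega
  rw [h1, h2, sq]

/-- Membership in the lattice square `[x₀, x₀ + r] × [y₀, y₀ + r]`. [folklore] -/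
theorem mem_Icc_square_iff {x₀ y₀ : ℤ} {r : ℕ} {v : Site 2} :
    v ∈ (Finset.Icc ![x₀, y₀] ![x₀ + r, y₀ + r] : Finset (Site 2)) ↔
      x₀ ≤ v 0 ∧ v 0 ≤ x₀ + r ∧ y₀ ≤ v 1 ∧ v 1 ≤ y₀ + r := by
  simp only [Finset.mem_Icc, Pi.le_def, Fin.forall_fin_two, Matrix.cons_val_zero, Matrix.cons_val_one]
  tauto

/-- **Bollobás–Riordan's chaining count in the strip `T = [0, n] × ℤ`** (proof of Thm. 5.3,
pp. 23–24, with the rounding made explicit). The strip is covered by `A` (containing its part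
below height `0`), `B` (containing its part at height `≥ y_B`) and a finite gap `G`; the path
`P ⊆ [0, w] × [0, h]` has marked points `s`, `e` with `e₁ ≥ s₁`; the starting square is
`R₀ = [x₀, x₀ + r] × [y₀, y₀ + r]` with `y₀ + r < 0`; `I ≥ 1` links climb to height `≥ y_B`
(`y_B ≤ y₀ + I (e₁ - s₁)`), and the chain fits horizontally (the endpoint inequalities
`w ≤ x₀ + j (e₀ - s₀)`, `x₀ + r + w + j (e₀ - s₀) ≤ n` at `j = 0` and `j = I`; B–R's
"`(2β₁+γ)n + I(x'-x) ≤ n`"). Then some finite set `Xs` of translations, all in the window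
`[-w, n] × [y₀ - h, y₀ + r + I (e₁ - s₁)]`, has `s + X ∈ A`, `e + X ∈ B`, `P + X ⊆ T` for every
`X ∈ Xs`, and `(r + 1)² ≤ I · #Xs + (I - 1) · #G`. [cite: BollobasRiordan2010, §5.1 proof of Thm. 5.3] -/
theorem exists_translates_linking_strip (n : ℕ) (A B : Set (Site 2)) (G : Finset (Site 2)) (yB : ℤ)
    (hAlow : ∀ z : Site 2, 0 ≤ z 0 → z 0 ≤ n → z 1 < 0 → z ∈ A)
    (hBhigh : ∀ z : Site 2, 0 ≤ z 0 → z 0 ≤ n → yB ≤ z 1 → z ∈ B)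
    (hcover : ∀ z : Site 2, 0 ≤ z 0 → z 0 ≤ n → z ∈ A ∨ z ∈ B ∨ z ∈ G)
    (P : Finset (Site 2)) (w h : ℕ) (hP : ∀ z ∈ P, 0 ≤ z 0 ∧ z 0 ≤ w ∧ 0 ≤ z 1 ∧ z 1 ≤ h)
    {s e : Site 2} (hs : s ∈ P) (ha : s 1 ≤ e 1) (x₀ r : ℕ) (y₀ : ℤ) (hy₀ : y₀ + r < 0)
    {I : ℕ} (hI : 1 ≤ I) (hclimb : yB ≤ y₀ + I * (e 1 - s 1))
    (hlo0 : (w : ℤ) ≤ x₀) (hloI : (w : ℤ) ≤ x₀ + I * (e 0 - s 0))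
    (hhi0 : (x₀ : ℤ) + r + w ≤ n) (hhiI : (x₀ : ℤ) + r + w + I * (e 0 - s 0) ≤ n) :
    ∃ Xs : Finset (Site 2),
      (∀ X ∈ Xs, -(w : ℤ) ≤ X 0 ∧ X 0 ≤ n ∧ y₀ - h ≤ X 1 ∧ X 1 ≤ y₀ + r + I * (e 1 - s 1)) ∧
      (∀ X ∈ Xs, s + X ∈ A ∧ e + X ∈ B ∧ ∀ z ∈ P, 0 ≤ (z + X) 0 ∧ (z + X) 0 ≤ n) ∧
      (r + 1) ^ 2 ≤ I * Xs.card + (I - 1) * G.card := by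
  have hsx := hP s hs
  -- horizontal fit of every link `j ≤ I`
  have hfit : ∀ v : Site 2, (x₀ : ℤ) ≤ v 0 → v 0 ≤ x₀ + r → ∀ j ≤ I, ∀ z ∈ P,
      0 ≤ (z + (v - s + j • (e - s))) 0 ∧ (z + (v - s + j • (e - s))) 0 ≤ n := by
    intro v hv1 hv2 j hj z hz
    rw [apply_add_linkVec_zero]
    have hz' := hP z hz
    have key := linear_mem_Icc_of_endpoints (c := (x₀ : ℤ)) (d := e 0 - s 0) (lo := w) (hi := n - r - w) hj
      hlo0 hloI (by omega) (by omega)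
    constructor <;> linarith [key.1, key.2]
  obtain ⟨Xs, hform, hgood, hcount⟩ := exists_translates_linking {z : Site 2 | 0 ≤ z 0 ∧ z 0 ≤ n} A B G
    (fun z hz => hcover z hz.1 hz.2) P hs (Finset.Icc ![(x₀ : ℤ), y₀] ![(x₀ : ℤ) + r, y₀ + r]) hI
    (fun v hv j hj z hz => by
      have hv' := mem_Icc_square_iff.1 hv
      exact hfit v hv'.1 hv'.2.1 j hj.le z hz)
    (fun v hv => by
      have hv' := mem_Icc_square_iff.1 hv
      exact hAlow v (by omega) (by omega) (by omega))
    (fun v hv => by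
      have hv' := mem_Icc_square_iff.1 hv
      have h0 := hfit v hv'.1 hv'.2.1 I le_rfl s hs
      rw [apply_add_linkVec_zero] at h0
      refine hBhigh _ ?_ ?_ ?_
      · rw [chainPoint_apply, Pi.sub_apply]; linarith [h0.1]
      · rw [chainPoint_apply, Pi.sub_apply]; linarith [h0.2]
      · rw [chainPoint_apply, Pi.sub_apply]; linarith [hv'.2.2.1])
  refine ⟨Xs, fun X hX => ?_, fun X hX => ?_, le_trans (le_of_eq (card_Icc_square _ _ _).symm) hcount⟩
  · obtain ⟨v, hv, i, hi1, hiI, rfl⟩ := hform X hX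
    have hv' := mem_Icc_square_iff.1 hv
    have him : i - 1 ≤ I := by omega
    have h0 := hfit v hv'.1 hv'.2.1 (i - 1) him s hs
    rw [apply_add_linkVec_zero] at h0
    have hc0 : (0 : ℤ) ≤ ((i - 1 : ℕ) : ℤ) := by exact_mod_cast Nat.zero_le _
    have hcI : ((i - 1 : ℕ) : ℤ) ≤ I := by exact_mod_cast him
    have hmul0 : 0 ≤ ((i - 1 : ℕ) : ℤ) * (e 1 - s 1) := mul_nonneg hc0 (by linarith)
    have hmulI : ((i - 1 : ℕ) : ℤ) * (e 1 - s 1) ≤ I * (e 1 - s 1) :=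
      mul_le_mul_of_nonneg_right hcI (by linarith)
    simp only [linkShift_apply, Pi.sub_apply]
    refine ⟨by linarith [h0.1], by linarith [h0.2], by linarith [hv'.2.2.1, hsx.2.2.2], by linarith [hv'.2.2.2, hsx.2.2.1]⟩
  · obtain ⟨h1, h2, h3⟩ := hgood X hX
    exact ⟨h1, h2, fun z hz => h3 z hz⟩

end Strip

end Literature.Probability.Percolation
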